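import Summits.CriticalPhenomena.PercolationContinuityZ3.Theorems.PercNearOneGluingNoHeavyLowerTailCILReduction
import Summits.CriticalPhenomena.PercolationContinuityZ3.Theorems.PercNearOneGluingAdditiveGluingOneBond
import Literature.Probability.LatticeModels.ProdBernoulliAtomExpansion
import HarnessLib

/-!
# `NoHeavyLowerTail` (stmt-CriticalPhenomena-4575) — MERGE STABILITY of the champion relay implies the
# cumulative isolation lemma at every level, hence the crux

Route `PercNearOneGluingNoHeavy`, seat `prim-gen-swap` (strategy: swap / deletion–contraction), 2026-08-18.
For bond percolation `μ_w = prodBernoulli w` on `Fin n`, relays `A`, observer `o ∉ A`, write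
`π(v) = {x ∈ A : v ↔ x}`, `N = |π(o)|`, and for a level `j`

  `L = {1 ≤ N ≤ j}`,   `R_a = {|π(a)| ≤ j}`   (`a ∈ A`).

The registered stub `stub_cumulativeIsolation` (CIL, lead of the one-cut line) is `∃ a ∈ A, μ(L) ≤ μ(R_a)` for
every weighted graph and every `j`; it closes the crux (`Theorems.noHeavyLowerTail_of_stub_cumulativeIsolation`).

**Merge stability (MS, the hypothesis `hMS` below; new registered stub `stub_mergeStability`).**  Let the pair
`s(o, v)` (`v ≠ o`, relay or not) carry weight `0` in `w`, and let `a⋆ ∈ A` be a CHAMPION of `w`: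
`μ_w(R_a) ≤ μ_w(R_{a⋆})` for all `a ∈ A`.  Then after GLUING `o` to `v` (`w' = w[s(o,v) ↦ 1]`) the champion of the
unglued graph is still feasible:  `μ_{w'}(L) ≤ μ_{w'}(R_{a⋆})`.

**Theorem (`cumulativeIsolation_of_mergeStability`).**  MS ⇒ CIL (all `n, w, A, o, j`).  Proof: induction on the
number of vertices `v ≠ o` with `w s(o,v) > 0`.  If there is none, `o` is almost surely isolated and `μ(L) = 0`
(`prodBernoulli_setOf_exists_mem_eq_zero`).  Otherwise pick such a `v`, put `e = s(o,v)`, `w₀ = w[e ↦ 0]`,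
`w₁ = w[e ↦ 1]`.  By induction CIL holds for `w₀`; a fortiori the champion `a⋆` of `w₀` satisfies
`μ_{w₀}(L) ≤ μ_{w₀}(R_{a⋆})`; by MS, `μ_{w₁}(L) ≤ μ_{w₁}(R_{a⋆})`; and by the one-bond decomposition
`μ_w(S) = (1 − w e) μ_{w₀}(S) + (w e) μ_{w₁}(S)` (tree: `stub_oneBondDecomp_k15`) applied to `S = L` and `S = R_{a⋆}`,
`μ_w(L) ≤ μ_w(R_{a⋆})`.  ∎   Hence `noHeavyLowerTail_of_mergeStability : MS → NoHeavyLowerTail`.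

Why MS: it is the deletion–contraction form of CIL — `μ_G = (1-p_e) μ_{G∖e} + p_e μ_{G/e}` — with the one piece of
information an induction on edges cannot supply by itself: a relay that is feasible for BOTH minors.  Evidence
(seat folder `work/lab/c/dcoedge.c`, report MERGE-STABILITY.md on the item): at `p = 1/2`, exhaustively over all
multigraphs with `o` + `k` relays + `f` free vertices and `m` edges, `(k,f,j,m≤) ∈ {(3,1,1,8),(3,2,1,7),(4,1,1,8),
(4,1,2,8),(4,2,2,7),(5,0,2,8),(5,1,2,7),(6,0,2,7),(6,0,3,7)}` — about `1.26·10⁷` (graph, `o`-edge) pairs — the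
champion of `G∖e` is feasible for `G/e` in EVERY case, while the converse (champion of `G/e` feasible for `G∖e`)
fails thousands of times; weighted random graphs (exact partition law, `k ≤ 5`, `j ≤ 2`): `0` failures.
-/

noncomputable section

namespace Summit.CriticalPhenomena.PercolationContinuityZ3.Theorems

open MeasureTheory Set Literature.Probability.LatticeModels Literature.Probability.Percolation
open scoped Classical BigOperators

variable {n : ℕ}

namespace MergeStability

/-- The small-nonempty-block event of the observer, `L = {1 ≤ N ≤ j}`. [folklore] -/
theorem L_subset_exists_mem (A : Finset (Fin n)) (o : Fin n) (j : ℕ) (ho : o ∉ A) :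
    {ω : BondConfig (Fin n) | 1 ≤ (A.filter fun x => ω ∈ openConn o x).card ∧
        (A.filter fun x => ω ∈ openConn o x).card ≤ j} ⊆
      {ω : BondConfig (Fin n) | ∃ e ∈ (Finset.univ.filter fun v : Fin n => v ≠ o).image (fun v => s(o, v)),
        e ∈ ω} := by
  intro ω hω
  obtain ⟨h1, -⟩ := hω
  obtain ⟨x, hx⟩ := Finset.card_pos.1 (by omega : 0 < (A.filter fun x => ω ∈ openConn o x).card)
  obtain ⟨hxA, hox⟩ := Finset.mem_filter.1 hx
  have hne : o ≠ x := fun h => ho (h ▸ hxA)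
  have hox' : (openGraph ω).Reachable o x := hox
  obtain ⟨p⟩ := hox'
  -- the first edge of a walk from `o` to `x ≠ o`
  have key : ∀ {u : Fin n} (q : (openGraph ω).Walk u x), u ≠ x →
      ∃ v : Fin n, (openGraph ω).Adj u v := by
    intro u q hux
    cases q with
    | nil => exact absurd rfl hux
    | cons h _ => exact ⟨_, h⟩
  obtain ⟨v, hadj⟩ := key p hne
  rw [openGraph_adj] at hadj
  have hvo : v ≠ o := fun hv => hadj.2 hv.symm
  refine ⟨s(o, v), ?_, hadj.1⟩
  exact Finset.mem_image.2 ⟨v, Finset.mem_filter.2 ⟨Finset.mem_univ _, hvo⟩, rfl⟩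

/-- Base case: if every pair at `o` has weight `0`, then `μ(1 ≤ N ≤ j) = 0`. [folklore] -/
theorem real_L_eq_zero_of_isolated (w : Sym2 (Fin n) → unitInterval) (A : Finset (Fin n)) (o : Fin n)
    (j : ℕ) (ho : o ∉ A) (hw : ∀ v : Fin n, v ≠ o → (w s(o, v) : ℝ) = 0) :
    (prodBernoulli w).real {ω : BondConfig (Fin n) | 1 ≤ (A.filter fun x => ω ∈ openConn o x).card ∧
        (A.filter fun x => ω ∈ openConn o x).card ≤ j} = 0 := by
  set F := (Finset.univ.filter fun v : Fin n => v ≠ o).image (fun v => s(o, v)) with hF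
  have hzero : prodBernoulli w {ω : BondConfig (Fin n) | ∃ e ∈ F, e ∈ ω} = 0 := by
    refine prodBernoulli_setOf_exists_mem_eq_zero w F fun e he => ?_
    obtain ⟨v, hv, rfl⟩ := Finset.mem_image.1 he
    exact hw v (Finset.mem_filter.1 hv).2
  have hle : (prodBernoulli w).real {ω : BondConfig (Fin n) |
      1 ≤ (A.filter fun x => ω ∈ openConn o x).card ∧
        (A.filter fun x => ω ∈ openConn o x).card ≤ j} ≤
      (prodBernoulli w).real {ω : BondConfig (Fin n) | ∃ e ∈ F, e ∈ ω} :=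
    measureReal_mono (L_subset_exists_mem A o j ho) (measure_ne_top _ _)
  have hz : (prodBernoulli w).real {ω : BondConfig (Fin n) | ∃ e ∈ F, e ∈ ω} = 0 := by
    rw [measureReal_def, hzero, ENNReal.toReal_zero]
  rw [hz] at hle
  exact le_antisymm hle measureReal_nonneg

/-- A champion exists: some `a⋆ ∈ A` maximises `μ(R_a)` over the nonempty finite set `A`. [folklore] -/
theorem exists_champion (μ : Measure (BondConfig (Fin n))) (A : Finset (Fin n)) (hA : A.Nonempty) (j : ℕ) :
    ∃ aStar ∈ A, ∀ a ∈ A,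
      μ.real {ω : BondConfig (Fin n) | (A.filter fun x => ω ∈ openConn a x).card ≤ j} ≤
        μ.real {ω : BondConfig (Fin n) | (A.filter fun x => ω ∈ openConn aStar x).card ≤ j} := by
  obtain ⟨aStar, haStar, hmax⟩ := Finset.exists_max_image A
    (fun a => μ.real {ω : BondConfig (Fin n) | (A.filter fun x => ω ∈ openConn a x).card ≤ j}) hA
  exact ⟨aStar, haStar, hmax⟩

end MergeStability

open MergeStability in
/-- **Merge stability of the champion implies the cumulative isolation lemma (all levels).**
Hypothesis `hMS` = the registered stub `stub_mergeStability`; conclusion = the registered stub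
`stub_cumulativeIsolation` verbatim.  Induction on the number of vertices `v ≠ o` with `w s(o,v) > 0`, one-bond
decomposition `μ_w = (1 - w e) μ_{w[e↦0]} + (w e) μ_{w[e↦1]}` (`stub_oneBondDecomp_k15`), MS for the gluing
`w[e↦0] ↦ w[e↦1]`. -/
theorem cumulativeIsolation_of_mergeStability
    (hMS : ∀ (n : ℕ) (w : Sym2 (Fin n) → unitInterval) (A : Finset (Fin n)) (o v aStar : Fin n) (j : ℕ),
      o ∉ A → v ≠ o → aStar ∈ A → w s(o, v) = 0 →
      (∀ a ∈ A,
        (Literature.Probability.LatticeModels.prodBernoulli w).real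
            {ω : Literature.Probability.Percolation.BondConfig (Fin n) |
              (A.filter fun x => ω ∈ Literature.Probability.Percolation.openConn a x).card ≤ j} ≤
          (Literature.Probability.LatticeModels.prodBernoulli w).real
            {ω : Literature.Probability.Percolation.BondConfig (Fin n) |
              (A.filter fun x => ω ∈ Literature.Probability.Percolation.openConn aStar x).card ≤ j}) →
      (Literature.Probability.LatticeModels.prodBernoulli (Function.update w s(o, v) 1)).real
          {ω : Literature.Probability.Percolation.BondConfig (Fin n) |
            1 ≤ (A.filter fun x => ω ∈ Literature.Probability.Percolation.openConn o x).card ∧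
              (A.filter fun x => ω ∈ Literature.Probability.Percolation.openConn o x).card ≤ j} ≤
        (Literature.Probability.LatticeModels.prodBernoulli (Function.update w s(o, v) 1)).real
          {ω : Literature.Probability.Percolation.BondConfig (Fin n) |
            (A.filter fun x => ω ∈ Literature.Probability.Percolation.openConn aStar x).card ≤ j}) :
    ∀ (n : ℕ) (w : Sym2 (Fin n) → unitInterval) (A : Finset (Fin n)) (o : Fin n) (j : ℕ),
      A.Nonempty → o ∉ A → ∃ a ∈ A,
        (Literature.Probability.LatticeModels.prodBernoulli w).real
            {ω : Literature.Probability.Percolation.BondConfig (Fin n) |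
              1 ≤ (A.filter fun x => ω ∈ Literature.Probability.Percolation.openConn o x).card ∧
                (A.filter fun x => ω ∈ Literature.Probability.Percolation.openConn o x).card ≤ j} ≤
          (Literature.Probability.LatticeModels.prodBernoulli w).real
            {ω : Literature.Probability.Percolation.BondConfig (Fin n) |
              (A.filter fun x => ω ∈ Literature.Probability.Percolation.openConn a x).card ≤ j} := by
  intro n w A o j hA ho
  -- induction on the number of positive-weight pairs at `o`
  suffices H : ∀ (m : ℕ) (w : Sym2 (Fin n) → unitInterval),
      (Finset.univ.filter fun v : Fin n => v ≠ o ∧ 0 < (w s(o, v) : ℝ)).card = m →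
      ∃ a ∈ A, (prodBernoulli w).real {ω : BondConfig (Fin n) |
          1 ≤ (A.filter fun x => ω ∈ openConn o x).card ∧ (A.filter fun x => ω ∈ openConn o x).card ≤ j} ≤
        (prodBernoulli w).real {ω : BondConfig (Fin n) | (A.filter fun x => ω ∈ openConn a x).card ≤ j} from
    H _ w rfl
  intro m
  induction m with
  | zero =>
    intro w hm
    obtain ⟨a, ha⟩ := hA
    refine ⟨a, ha, ?_⟩
    have hw : ∀ v : Fin n, v ≠ o → (w s(o, v) : ℝ) = 0 := by
      intro v hv
      by_contra hne
      have hpos : 0 < (w s(o, v) : ℝ) := lt_of_le_of_ne (w s(o, v)).2.1 (Ne.symm hne)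
      have hmem : v ∈ (Finset.univ.filter fun v : Fin n => v ≠ o ∧ 0 < (w s(o, v) : ℝ)) :=
        Finset.mem_filter.2 ⟨Finset.mem_univ _, hv, hpos⟩
      rw [Finset.card_eq_zero] at hm
      rw [hm] at hmem
      exact Finset.notMem_empty v hmem
    rw [real_L_eq_zero_of_isolated w A o j ho hw]
    exact measureReal_nonneg
  | succ m ih =>
    intro w hm
    -- pick a positive-weight pair `e = s(o, v)`
    obtain ⟨v, hv⟩ := Finset.card_pos.1
      (by omega : 0 < (Finset.univ.filter fun v : Fin n => v ≠ o ∧ 0 < (w s(o, v) : ℝ)).card)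
    obtain ⟨-, hvo, hvpos⟩ := Finset.mem_filter.1 hv
    set e : Sym2 (Fin n) := s(o, v) with he
    set w₀ : Sym2 (Fin n) → unitInterval := Function.update w e 0 with hw₀
    set w₁ : Sym2 (Fin n) → unitInterval := Function.update w e 1 with hw₁
    -- the count drops by one for `w₀`
    have hcount : (Finset.univ.filter fun u : Fin n => u ≠ o ∧ 0 < (w₀ s(o, u) : ℝ)).card = m := by
      have hset : (Finset.univ.filter fun u : Fin n => u ≠ o ∧ 0 < (w₀ s(o, u) : ℝ)) =
          (Finset.univ.filter fun u : Fin n => u ≠ o ∧ 0 < (w s(o, u) : ℝ)).erase v := by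
        ext u
        simp only [Finset.mem_filter, Finset.mem_univ, true_and, Finset.mem_erase]
        by_cases huv : u = v
        · subst huv
          simp [hw₀, he]
        · have hne : s(o, u) ≠ e := by
            rw [he]
            intro h
            exact huv (Sym2.congr_right.1 h)
          simp [hw₀, Function.update_of_ne hne, huv]
      rw [hset, Finset.card_erase_of_mem hv, hm]
      rfl
    -- induction hypothesis for `w₀`, upgraded to the champion of `w₀`
    obtain ⟨a₀, ha₀, hCIL₀⟩ := ih w₀ hcount
    obtain ⟨aStar, haStar, hchamp⟩ := exists_champion (prodBernoulli w₀) A hA j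
    have hL₀ : (prodBernoulli w₀).real {ω : BondConfig (Fin n) |
        1 ≤ (A.filter fun x => ω ∈ openConn o x).card ∧ (A.filter fun x => ω ∈ openConn o x).card ≤ j} ≤
        (prodBernoulli w₀).real {ω : BondConfig (Fin n) | (A.filter fun x => ω ∈ openConn aStar x).card ≤ j} :=
      hCIL₀.trans (hchamp a₀ ha₀)
    -- merge stability for the gluing `w₀ ↦ w₀[e ↦ 1] = w₁`
    have hw₀e : w₀ s(o, v) = 0 := by simp [hw₀, he]
    have hMS' := hMS n w₀ A o v aStar j ho hvo haStar hw₀e hchamp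
    have hw₁eq : Function.update w₀ s(o, v) 1 = w₁ := by
      rw [hw₀, hw₁, he, Function.update_idem]
    rw [hw₁eq] at hMS'
    -- one-bond decomposition for both events
    refine ⟨aStar, haStar, ?_⟩
    have hp0 : 0 ≤ (w e : ℝ) := (w e).2.1
    have hp1 : (w e : ℝ) ≤ 1 := (w e).2.2
    rw [stub_oneBondDecomp_k15 n w e {ω : BondConfig (Fin n) |
        1 ≤ (A.filter fun x => ω ∈ openConn o x).card ∧ (A.filter fun x => ω ∈ openConn o x).card ≤ j},
      stub_oneBondDecomp_k15 n w e {ω : BondConfig (Fin n) |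
        (A.filter fun x => ω ∈ openConn aStar x).card ≤ j}]
    have h0 : (1 - (w e : ℝ)) * (prodBernoulli w₀).real {ω : BondConfig (Fin n) |
          1 ≤ (A.filter fun x => ω ∈ openConn o x).card ∧ (A.filter fun x => ω ∈ openConn o x).card ≤ j} ≤
        (1 - (w e : ℝ)) * (prodBernoulli w₀).real {ω : BondConfig (Fin n) |
          (A.filter fun x => ω ∈ openConn aStar x).card ≤ j} :=
      mul_le_mul_of_nonneg_left hL₀ (by linarith)
    have h1 : (w e : ℝ) * (prodBernoulli w₁).real {ω : BondConfig (Fin n) |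
          1 ≤ (A.filter fun x => ω ∈ openConn o x).card ∧ (A.filter fun x => ω ∈ openConn o x).card ≤ j} ≤
        (w e : ℝ) * (prodBernoulli w₁).real {ω : BondConfig (Fin n) |
          (A.filter fun x => ω ∈ openConn aStar x).card ≤ j} :=
      mul_le_mul_of_nonneg_left hMS' hp0
    exact add_le_add h0 h1

/-- **Merge stability closes the crux**: `stub_mergeStability → NoHeavyLowerTail`, through
`cumulativeIsolation_of_mergeStability` and the landed `noHeavyLowerTail_of_stub_cumulativeIsolation`. -/
theorem noHeavyLowerTail_of_mergeStability
    (hMS : ∀ (n : ℕ) (w : Sym2 (Fin n) → unitInterval) (A : Finset (Fin n)) (o v aStar : Fin n) (j : ℕ),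
      o ∉ A → v ≠ o → aStar ∈ A → w s(o, v) = 0 →
      (∀ a ∈ A,
        (Literature.Probability.LatticeModels.prodBernoulli w).real
            {ω : Literature.Probability.Percolation.BondConfig (Fin n) |
              (A.filter fun x => ω ∈ Literature.Probability.Percolation.openConn a x).card ≤ j} ≤
          (Literature.Probability.LatticeModels.prodBernoulli w).real
            {ω : Literature.Probability.Percolation.BondConfig (Fin n) |
              (A.filter fun x => ω ∈ Literature.Probability.Percolation.openConn aStar x).card ≤ j}) →
      (Literature.Probability.LatticeModels.prodBernoulli (Function.update w s(o, v) 1)).real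
          {ω : Literature.Probability.Percolation.BondConfig (Fin n) |
            1 ≤ (A.filter fun x => ω ∈ Literature.Probability.Percolation.openConn o x).card ∧
              (A.filter fun x => ω ∈ Literature.Probability.Percolation.openConn o x).card ≤ j} ≤
        (Literature.Probability.LatticeModels.prodBernoulli (Function.update w s(o, v) 1)).real
          {ω : Literature.Probability.Percolation.BondConfig (Fin n) |
            (A.filter fun x => ω ∈ Literature.Probability.Percolation.openConn aStar x).card ≤ j}) :
    Summit.CriticalPhenomena.PercolationContinuityZ3.Theses.PercNearOneGluing.NoHeavyLowerTail :=
  noHeavyLowerTail_of_stub_cumulativeIsolation (cumulativeIsolation_of_mergeStability hMS)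


/-! ### Weak merge stability: the champion may be assumed feasible before the gluing

In the induction the graph `w₀ = w[e ↦ 0]` already satisfies CIL (induction hypothesis), so the merge
stability hypothesis may be weakened by the extra premise `μ_{w}(L) ≤ μ_{w}(R_{a⋆})` ("the champion of `w` is
feasible for `w`").  Registered stub `stub_mergeStabilityWeak`; it is implied by `stub_mergeStability` and still
closes the crux. -/

open MergeStability in
/-- **Weak merge stability implies the cumulative isolation lemma (all levels).**  Same induction as
`cumulativeIsolation_of_mergeStability`, feeding the induction hypothesis `μ_{w₀}(L) ≤ μ_{w₀}(R_{a⋆})` to the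
(weaker) merge-stability hypothesis. -/
theorem cumulativeIsolation_of_mergeStabilityWeak
    (hMS : ∀ (n : ℕ) (w : Sym2 (Fin n) → unitInterval) (A : Finset (Fin n)) (o v aStar : Fin n) (j : ℕ),
      o ∉ A → v ≠ o → aStar ∈ A → w s(o, v) = 0 →
      (∀ a ∈ A,
        (Literature.Probability.LatticeModels.prodBernoulli w).real
            {ω : Literature.Probability.Percolation.BondConfig (Fin n) |
              (A.filter fun x => ω ∈ Literature.Probability.Percolation.openConn a x).card ≤ j} ≤
          (Literature.Probability.LatticeModels.prodBernoulli w).real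
            {ω : Literature.Probability.Percolation.BondConfig (Fin n) |
              (A.filter fun x => ω ∈ Literature.Probability.Percolation.openConn aStar x).card ≤ j}) →
      (Literature.Probability.LatticeModels.prodBernoulli w).real
          {ω : Literature.Probability.Percolation.BondConfig (Fin n) |
            1 ≤ (A.filter fun x => ω ∈ Literature.Probability.Percolation.openConn o x).card ∧
              (A.filter fun x => ω ∈ Literature.Probability.Percolation.openConn o x).card ≤ j} ≤
        (Literature.Probability.LatticeModels.prodBernoulli w).real
          {ω : Literature.Probability.Percolation.BondConfig (Fin n) |
            (A.filter fun x => ω ∈ Literature.Probability.Percolation.openConn aStar x).card ≤ j} →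
      (Literature.Probability.LatticeModels.prodBernoulli (Function.update w s(o, v) 1)).real
          {ω : Literature.Probability.Percolation.BondConfig (Fin n) |
            1 ≤ (A.filter fun x => ω ∈ Literature.Probability.Percolation.openConn o x).card ∧
              (A.filter fun x => ω ∈ Literature.Probability.Percolation.openConn o x).card ≤ j} ≤
        (Literature.Probability.LatticeModels.prodBernoulli (Function.update w s(o, v) 1)).real
          {ω : Literature.Probability.Percolation.BondConfig (Fin n) |
            (A.filter fun x => ω ∈ Literature.Probability.Percolation.openConn aStar x).card ≤ j}) :
    ∀ (n : ℕ) (w : Sym2 (Fin n) → unitInterval) (A : Finset (Fin n)) (o : Fin n) (j : ℕ),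
      A.Nonempty → o ∉ A → ∃ a ∈ A,
        (Literature.Probability.LatticeModels.prodBernoulli w).real
            {ω : Literature.Probability.Percolation.BondConfig (Fin n) |
              1 ≤ (A.filter fun x => ω ∈ Literature.Probability.Percolation.openConn o x).card ∧
                (A.filter fun x => ω ∈ Literature.Probability.Percolation.openConn o x).card ≤ j} ≤
          (Literature.Probability.LatticeModels.prodBernoulli w).real
            {ω : Literature.Probability.Percolation.BondConfig (Fin n) |
              (A.filter fun x => ω ∈ Literature.Probability.Percolation.openConn a x).card ≤ j} := by
  intro n w A o j hA ho
  suffices H : ∀ (m : ℕ) (w : Sym2 (Fin n) → unitInterval),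
      (Finset.univ.filter fun v : Fin n => v ≠ o ∧ 0 < (w s(o, v) : ℝ)).card = m →
      ∃ a ∈ A, (prodBernoulli w).real {ω : BondConfig (Fin n) |
          1 ≤ (A.filter fun x => ω ∈ openConn o x).card ∧ (A.filter fun x => ω ∈ openConn o x).card ≤ j} ≤
        (prodBernoulli w).real {ω : BondConfig (Fin n) | (A.filter fun x => ω ∈ openConn a x).card ≤ j} from
    H _ w rfl
  intro m
  induction m with
  | zero =>
    intro w hm
    obtain ⟨a, ha⟩ := hA
    refine ⟨a, ha, ?_⟩
    have hw : ∀ v : Fin n, v ≠ o → (w s(o, v) : ℝ) = 0 := by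
      intro v hv
      by_contra hne
      have hpos : 0 < (w s(o, v) : ℝ) := lt_of_le_of_ne (w s(o, v)).2.1 (Ne.symm hne)
      have hmem : v ∈ (Finset.univ.filter fun v : Fin n => v ≠ o ∧ 0 < (w s(o, v) : ℝ)) :=
        Finset.mem_filter.2 ⟨Finset.mem_univ _, hv, hpos⟩
      rw [Finset.card_eq_zero] at hm
      rw [hm] at hmem
      exact Finset.notMem_empty v hmem
    rw [real_L_eq_zero_of_isolated w A o j ho hw]
    exact measureReal_nonneg
  | succ m ih =>
    intro w hm
    obtain ⟨v, hv⟩ := Finset.card_pos.1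
      (by omega : 0 < (Finset.univ.filter fun v : Fin n => v ≠ o ∧ 0 < (w s(o, v) : ℝ)).card)
    obtain ⟨-, hvo, hvpos⟩ := Finset.mem_filter.1 hv
    set e : Sym2 (Fin n) := s(o, v) with he
    set w₀ : Sym2 (Fin n) → unitInterval := Function.update w e 0 with hw₀
    set w₁ : Sym2 (Fin n) → unitInterval := Function.update w e 1 with hw₁
    have hcount : (Finset.univ.filter fun u : Fin n => u ≠ o ∧ 0 < (w₀ s(o, u) : ℝ)).card = m := by
      have hset : (Finset.univ.filter fun u : Fin n => u ≠ o ∧ 0 < (w₀ s(o, u) : ℝ)) =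
          (Finset.univ.filter fun u : Fin n => u ≠ o ∧ 0 < (w s(o, u) : ℝ)).erase v := by
        ext u
        simp only [Finset.mem_filter, Finset.mem_univ, true_and, Finset.mem_erase]
        by_cases huv : u = v
        · subst huv
          simp [hw₀, he]
        · have hne : s(o, u) ≠ e := by
            rw [he]
            intro h
            exact huv (Sym2.congr_right.1 h)
          simp [hw₀, Function.update_of_ne hne, huv]
      rw [hset, Finset.card_erase_of_mem hv, hm]
      rfl
    obtain ⟨a₀, ha₀, hCIL₀⟩ := ih w₀ hcount
    obtain ⟨aStar, haStar, hchamp⟩ := exists_champion (prodBernoulli w₀) A hA j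
    have hL₀ : (prodBernoulli w₀).real {ω : BondConfig (Fin n) |
        1 ≤ (A.filter fun x => ω ∈ openConn o x).card ∧ (A.filter fun x => ω ∈ openConn o x).card ≤ j} ≤
        (prodBernoulli w₀).real {ω : BondConfig (Fin n) | (A.filter fun x => ω ∈ openConn aStar x).card ≤ j} :=
      hCIL₀.trans (hchamp a₀ ha₀)
    have hw₀e : w₀ s(o, v) = 0 := by simp [hw₀, he]
    have hMS' := hMS n w₀ A o v aStar j ho hvo haStar hw₀e hchamp hL₀
    have hw₁eq : Function.update w₀ s(o, v) 1 = w₁ := by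
      rw [hw₀, hw₁, he, Function.update_idem]
    rw [hw₁eq] at hMS'
    refine ⟨aStar, haStar, ?_⟩
    have hp0 : 0 ≤ (w e : ℝ) := (w e).2.1
    have hp1 : (w e : ℝ) ≤ 1 := (w e).2.2
    rw [stub_oneBondDecomp_k15 n w e {ω : BondConfig (Fin n) |
        1 ≤ (A.filter fun x => ω ∈ openConn o x).card ∧ (A.filter fun x => ω ∈ openConn o x).card ≤ j},
      stub_oneBondDecomp_k15 n w e {ω : BondConfig (Fin n) |
        (A.filter fun x => ω ∈ openConn aStar x).card ≤ j}]
    have h0 : (1 - (w e : ℝ)) * (prodBernoulli w₀).real {ω : BondConfig (Fin n) |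
          1 ≤ (A.filter fun x => ω ∈ openConn o x).card ∧ (A.filter fun x => ω ∈ openConn o x).card ≤ j} ≤
        (1 - (w e : ℝ)) * (prodBernoulli w₀).real {ω : BondConfig (Fin n) |
          (A.filter fun x => ω ∈ openConn aStar x).card ≤ j} :=
      mul_le_mul_of_nonneg_left hL₀ (by linarith)
    have h1 : (w e : ℝ) * (prodBernoulli w₁).real {ω : BondConfig (Fin n) |
          1 ≤ (A.filter fun x => ω ∈ openConn o x).card ∧ (A.filter fun x => ω ∈ openConn o x).card ≤ j} ≤
        (w e : ℝ) * (prodBernoulli w₁).real {ω : BondConfig (Fin n) |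
          (A.filter fun x => ω ∈ openConn aStar x).card ≤ j} :=
      mul_le_mul_of_nonneg_left hMS' hp0
    exact add_le_add h0 h1

/-- **Weak merge stability closes the crux**: `stub_mergeStabilityWeak → NoHeavyLowerTail`. -/
theorem noHeavyLowerTail_of_mergeStabilityWeak
    (hMS : ∀ (n : ℕ) (w : Sym2 (Fin n) → unitInterval) (A : Finset (Fin n)) (o v aStar : Fin n) (j : ℕ),
      o ∉ A → v ≠ o → aStar ∈ A → w s(o, v) = 0 →
      (∀ a ∈ A,
        (Literature.Probability.LatticeModels.prodBernoulli w).real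
            {ω : Literature.Probability.Percolation.BondConfig (Fin n) |
              (A.filter fun x => ω ∈ Literature.Probability.Percolation.openConn a x).card ≤ j} ≤
          (Literature.Probability.LatticeModels.prodBernoulli w).real
            {ω : Literature.Probability.Percolation.BondConfig (Fin n) |
              (A.filter fun x => ω ∈ Literature.Probability.Percolation.openConn aStar x).card ≤ j}) →
      (Literature.Probability.LatticeModels.prodBernoulli w).real
          {ω : Literature.Probability.Percolation.BondConfig (Fin n) |
            1 ≤ (A.filter fun x => ω ∈ Literature.Probability.Percolation.openConn o x).card ∧
              (A.filter fun x => ω ∈ Literature.Probability.Percolation.openConn o x).card ≤ j} ≤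
        (Literature.Probability.LatticeModels.prodBernoulli w).real
          {ω : Literature.Probability.Percolation.BondConfig (Fin n) |
            (A.filter fun x => ω ∈ Literature.Probability.Percolation.openConn aStar x).card ≤ j} →
      (Literature.Probability.LatticeModels.prodBernoulli (Function.update w s(o, v) 1)).real
          {ω : Literature.Probability.Percolation.BondConfig (Fin n) |
            1 ≤ (A.filter fun x => ω ∈ Literature.Probability.Percolation.openConn o x).card ∧
              (A.filter fun x => ω ∈ Literature.Probability.Percolation.openConn o x).card ≤ j} ≤
        (Literature.Probability.LatticeModels.prodBernoulli (Function.update w s(o, v) 1)).real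
          {ω : Literature.Probability.Percolation.BondConfig (Fin n) |
            (A.filter fun x => ω ∈ Literature.Probability.Percolation.openConn aStar x).card ≤ j}) :
    Summit.CriticalPhenomena.PercolationContinuityZ3.Theses.PercNearOneGluing.NoHeavyLowerTail :=
  noHeavyLowerTail_of_stub_cumulativeIsolation (cumulativeIsolation_of_mergeStabilityWeak hMS)

end Summit.CriticalPhenomena.PercolationContinuityZ3.Theorems

end
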